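import Summits.ValiantsHypothesis.ValiantsHypothesis.Theorems.KPlusLogSqLawTropicalBConvexPositionDefs
import Summits.ValiantsHypothesis.ValiantsHypothesis.Theorems.LacunarySymmetroidMatrixDescartesCensusTropicalKLawSlopes

/-!
# Route `KPlusLogSqLaw`, crux `TropicalB` — the HINGE LAW: the complete chain-internal obstruction
# («no linear relation among the terms of a dominant chain lies in the convexity cone of its slope sequence»)

HONEST FRAMING.  Helper file (seat val-sym-trop-p1 g11, cell `pub-symmetroid`, 2026-08-27) toward the registered stubs `stub_tropThin` /
`stub_tropFat` of `Cruxes/TropicalB/Lines/birth.lean` (crux `Summit.ValiantsHypothesis.ValiantsHypothesis.Theses.KPlusLogSqLaw.TropicalB`,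
ledger item `stmt-ValiantsHypothesis-19771`, route `KPlusLogSqLaw`, DRAFT).  A STRUCTURE law about chains of unique optima of an ARBITRARY
dominance design (any format, any exponents, no sign condition); it bounds nothing by itself and asserts nothing about `TropicalB` in its
window, `WeakLifting`, `KPlusLogSqLaw`, `MatrixDescartes` (`stmt-ValiantsHypothesis-18050`) or `VP ≠ VNP`.  It is the master form of the
cell's chain-internal laws (Sidon / parallelogram law and ARC LAW of `…TropicalBConvexPosition(Arc)`, the Latin and multi-exchange laws of
`…TropicalBMultiExchange` restricted to chain terms): each of those excludes ONE family of linear relations among dominant terms; this file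
characterises ALL excluded relations at once.

THE LAW (`hinge_law`, chain form `chain_hinge_law`).  Let `p₀, …, pₙ` be unique optima of one design at integer slopes
`θ₀ < θ₁ < ⋯ < θₙ`, consecutive terms distinct, and write `S_k = slope d p_k` (total exponent).  Let integers `μ₀, …, μₙ` be a LINEAR
RELATION among the terms read as incidence vectors: `Σ_k μ_k · ev F p_k = 0` for every entry-class weight table `F` (equivalently
`Σ_k μ_k · inc p_k = 0` in the free abelian group on incidences; `ConvexPosition.ev`, `ConvexPosition.inc`).  If every HINGE SUM is
non-negative,

  `H_j(μ) = Σ_{k > j} μ_k · (S_k − S_j) ≥ 0`  for all `0 < j < n`,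

then `μ = 0` (for `m ≥ 1`).  Equivalently: a non-trivial relation has a negative hinge sum AND (apply the law to `−μ`) a positive one.
READING.  The functionals `1, S, (S − S_j)⁺ (0 < j < n)` generate (affine part with both signs, hinges with non-negative coefficients) the
cone of sequences that are CONVEX along `S₀ < ⋯ < Sₙ`; so `H_j(μ) ≥ 0 ∀j` says exactly that `μ` pairs non-negatively with every convex
sequence, i.e. non-positively with every concave one — `μ` lies in the dual of the concavity cone.  The valuations `k ↦ −Σ v` of a dominant
chain are STRICTLY concave along the slopes (each `p_j` beats `p_{j−1}` and `p_{j+1}` at `θ_j`, so the chord slopes `r_j = (V_{j+1} −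
V_j)/(S_{j+1} − S_j)` satisfy `r_{j−1} < θ_j < r_j`), and a relation among incidence vectors transfers to the valuations (`Σ μ_k V_k = 0`),
to the slopes and to the constant table; Abel summation twice turns `Σ μ_k V_k` into `−Σ_j (r_{j+1} − r_j)·B_j` with `B_{j−1} = H_j(μ)`, a sum
of non-negative terms that vanishes only if every `B_j` does, whence `μ = 0` by undoing the two summations (`core`).  By Farkas' lemma the
law is COMPLETE for chain-internal realisability: if no non-zero `μ` in the cone is a relation among given candidate terms with prescribed
increasing slopes, valuations putting them in strictly convex position exist (competitors outside the chain are a separate matter — the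
multi-exchange law's non-chain terms); the completeness half is not formalised here.  Instances: the parallelogram `μ = e_a − e_b − e_c +
e_d` (`S_a + S_d = S_b + S_c`, `a < b ≤ c < d`) has all hinge sums `≥ 0` — the Sidon law; a relation non-negative off an arc and
non-positive on it lies in the cone by the chord argument — the arc law.  [folklore: Farkas dual of the realisability LP; the packaging is
the cell's]
-/

set_option linter.dupNamespace false
set_option autoImplicit false

namespace Summit.ValiantsHypothesis.ValiantsHypothesis.Theorems.KPlusLogSqLaw.HingeLaw

open Summit.ValiantsHypothesis.ValiantsHypothesis.Theorems.MatrixDescartes.Negative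
open Summit.ValiantsHypothesis.ValiantsHypothesis.Theorems.KPlusLogSqLaw.ConvexPosition
open scoped BigOperators
open Finset

/-! ## 1. Abel summation and the algebraic core -/

/-- Abel summation with prefix sums `A k = Σ_{i ≤ k} μ i`:
`Σ_{k ≤ N} μ_k g_k = A_N g_N − Σ_{k < N} A_k (g_{k+1} − g_k)`. [folklore] -/
theorem abel (μ g : ℕ → ℚ) (N : ℕ) :
    ∑ k ∈ range (N + 1), μ k * g k =
      (∑ i ∈ range (N + 1), μ i) * g N - ∑ k ∈ range N, (∑ i ∈ range (k + 1), μ i) * (g (k + 1) - g k) := by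
  induction N with
  | zero => simp
  | succ N ih =>
    rw [sum_range_succ, ih, sum_range_succ (fun k => (∑ i ∈ range (k + 1), μ i) * (g (k + 1) - g k)),
      sum_range_succ μ (N + 1)]
    ring

/-- **Algebraic core.**  Let `s_k > 0` (`k < n`) be gaps and `r_k` (`k < n`) chord slopes, strictly increasing; let `μ` have total sum
`0`, `Σ_{k<n} A_k s_k = 0` and `Σ_{k<n} A_k s_k r_k = 0` for its prefix sums `A_k`, and non-negative double prefix sums
`B_k = Σ_{i ≤ k} A_i s_i ≥ 0` (`k + 1 < n`).  Then `μ = 0` on `[0, n]`. [folklore] -/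
theorem core (n : ℕ) (μ s r : ℕ → ℚ) (hs : ∀ k < n, 0 < s k) (hr : ∀ k, k + 1 < n → r k < r (k + 1))
    (hsum : ∑ i ∈ range (n + 1), μ i = 0)
    (hS : ∑ k ∈ range n, (∑ i ∈ range (k + 1), μ i) * s k = 0)
    (hV : ∑ k ∈ range n, (∑ i ∈ range (k + 1), μ i) * s k * r k = 0)
    (hB : ∀ k, k + 1 < n → 0 ≤ ∑ i ∈ range (k + 1), (∑ l ∈ range (i + 1), μ l) * s i) :
    ∀ k ≤ n, μ k = 0 := by
  -- notation-free abbreviations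
  set A : ℕ → ℚ := fun k => ∑ i ∈ range (k + 1), μ i with hA
  set B : ℕ → ℚ := fun k => ∑ i ∈ range (k + 1), A i * s i with hBdef
  -- Step 1: every `B k` with `k < n` vanishes.
  have hBzero : ∀ k < n, B k = 0 := by
    rcases Nat.eq_zero_or_pos n with hn | hn
    · intro k hk; omega
    · -- `B (n-1) = 0` is `hS`; Abel once more: `Σ_{k<n} A_k s_k r_k = B_{n-1} r_{n-1} − Σ_{k<n-1} B_k (r_{k+1} − r_k)`
      obtain ⟨n', rfl⟩ : ∃ n', n = n' + 1 := ⟨n - 1, by omega⟩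
      have hBlast : B n' = 0 := by simp only [hBdef, hA]; exact hS
      have hab := abel (fun k => A k * s k) r n'
      -- rewrite `hV` through `hab`
      have hV' : ∑ k ∈ range (n' + 1), A k * s k * r k = 0 := by simp only [hA]; exact hV
      rw [hab] at hV'
      have hsumB : ∑ k ∈ range n', (∑ i ∈ range (k + 1), A i * s i) * (r (k + 1) - r k) = 0 := by
        have : (∑ i ∈ range (n' + 1), A i * s i) = B n' := rfl
        rw [this, hBlast, zero_mul, zero_sub, neg_eq_zero] at hV'
        exact hV'
      -- all terms are non-negative, so each vanishes
      have hterms : ∀ k ∈ range n', (∑ i ∈ range (k + 1), A i * s i) * (r (k + 1) - r k) = 0 := by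
        refine (sum_eq_zero_iff_of_nonneg fun k hk => ?_).mp hsumB
        rw [mem_range] at hk
        exact mul_nonneg (hB k (by omega)) (by linarith [hr k (by omega)])
      intro k hk
      rcases Nat.lt_or_ge k n' with hk' | hk'
      · have h := hterms k (mem_range.mpr hk')
        rcases mul_eq_zero.mp h with h | h
        · exact h
        · exfalso; linarith [hr k (by omega)]
      · have : k = n' := by omega
        subst this; exact hBlast
  -- Step 2: every `A k` with `k < n` vanishes (`A_k s_k = B_k − B_{k-1}`), and `A n = 0` is `hsum`.
  have hAzero : ∀ k ≤ n, A k = 0 := by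
    intro k hk
    rcases Nat.lt_or_ge k n with hkn | hkn
    · have hk0 : A k * s k = 0 := by
        rcases Nat.eq_zero_or_pos k with rfl | hkpos
        · have := hBzero 0 hkn
          simpa [hBdef] using this
        · obtain ⟨k', rfl⟩ : ∃ k', k = k' + 1 := ⟨k - 1, by omega⟩
          have h1 := hBzero (k' + 1) hkn
          have h2 := hBzero k' (by omega)
          have e : B (k' + 1) = B k' + A (k' + 1) * s (k' + 1) := by
            simp only [hBdef]
            rw [sum_range_succ]
          linarith
      rcases mul_eq_zero.mp hk0 with h | h
      · exact h
      · exfalso; linarith [hs k hkn]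
    · have : k = n := by omega
      subst this
      simpa [hA] using hsum
  -- Step 3: `μ_k = A_k − A_{k-1}`.
  intro k hk
  rcases Nat.eq_zero_or_pos k with rfl | hkpos
  · simpa [hA] using hAzero 0 hk
  · obtain ⟨k', rfl⟩ : ∃ k', k = k' + 1 := ⟨k - 1, by omega⟩
    have h1 := hAzero (k' + 1) hk
    have h2 := hAzero k' (by omega)
    have e : A (k' + 1) = A k' + μ (k' + 1) := by
      simp only [hA]
      rw [sum_range_succ]
    linarith

/-- Hinge sums are double prefix sums: if `Σ_{k≤n} μ_k = 0` and `Σ_{k≤n} μ_k S_k = 0` then for `0 < j ≤ n`,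
`Σ_{k ≤ n, j < k} μ_k (S_k − S_j) = Σ_{i < j} A_i (S_{i+1} − S_i)`. [folklore] -/
theorem hinge_eq_double_prefix (n : ℕ) (μ S : ℕ → ℚ) (hsum : ∑ i ∈ range (n + 1), μ i = 0)
    (hS : ∑ i ∈ range (n + 1), μ i * S i = 0) (j : ℕ) (hj : j ≤ n) :
    ∑ k ∈ range (n + 1), (if j < k then μ k * (S k - S j) else 0) =
      ∑ i ∈ range j, (∑ l ∈ range (i + 1), μ l) * (S (i + 1) - S i) := by
  -- `Σ_{k>j} μ_k (S_k − S_j) = Σ_k μ_k (S_k − S_j) − Σ_{k≤j} μ_k (S_k − S_j) = 0 + Σ_{k ≤ j} μ_k (S_j − S_k)`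
  have htot : ∑ k ∈ range (n + 1), μ k * (S k - S j) = 0 := by
    have : ∑ k ∈ range (n + 1), μ k * (S k - S j) = ∑ k ∈ range (n + 1), μ k * S k - (∑ k ∈ range (n + 1), μ k) * S j := by
      rw [sum_mul, ← sum_sub_distrib]; refine sum_congr rfl fun k _ => by ring
    rw [this, hS, hsum]; ring
  have hsplit : ∑ k ∈ range (n + 1), (if j < k then μ k * (S k - S j) else 0) =
      ∑ k ∈ range (n + 1), μ k * (S k - S j) - ∑ k ∈ range (j + 1), μ k * (S k - S j) := by
    have hA := sum_range_add_sum_Ico (fun k => μ k * (S k - S j)) (show j + 1 ≤ n + 1 by omega)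
    have hB := sum_range_add_sum_Ico (fun k => if j < k then μ k * (S k - S j) else 0) (show j + 1 ≤ n + 1 by omega)
    have h1 : ∑ k ∈ range (j + 1), (if j < k then μ k * (S k - S j) else 0) = 0 :=
      sum_eq_zero fun k hk => by rw [mem_range] at hk; simp [show ¬ j < k by omega]
    have h2 : ∑ k ∈ Ico (j + 1) (n + 1), (if j < k then μ k * (S k - S j) else 0) =
        ∑ k ∈ Ico (j + 1) (n + 1), μ k * (S k - S j) :=
      sum_congr rfl fun k hk => by rw [mem_Ico] at hk; simp [show j < k by omega]
    rw [h1, h2, zero_add] at hB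
    rw [← hB, ← hA]; ring
  rw [hsplit, htot, zero_sub]
  -- `−Σ_{k≤j} μ_k (S_k − S_j) = Σ_{i<j} A_i (S_{i+1} − S_i)` by Abel summation on `[0, j]`
  rw [abel μ (fun k => S k - S j) j]
  simp only [sub_self, mul_zero, zero_sub, neg_neg]
  refine sum_congr rfl fun i _ => by ring

/-! ## 2. The hinge law for dominant chains -/

variable {m K : ℕ} (d : Fin K → ℕ) (v ε : Fin m → Fin m → Fin K → ℤ)

/-- the valuation sum of a term, `Σ_b v (σ b) b (λ b)`, is the evaluation of the valuation table. [folklore] -/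
theorem val_eq_ev (p : Equiv.Perm (Fin m) × (Fin m → Fin K)) :
    (∑ b, v (p.1 b) b (p.2 b)) = ev (fun x => v x.1 x.2.1 x.2.2) p := by
  rw [ev_eq_sum]

/-- the slope of a term is the evaluation of the exponent table. [folklore] -/
theorem slope_eq_ev (p : Equiv.Perm (Fin m) × (Fin m → Fin K)) :
    Summit.ValiantsHypothesis.ValiantsHypothesis.Theorems.LacunarySymmetroidMatrixDescartes.TropicalCensus.slope d p =
      ev (fun x => (d x.2.2 : ℤ)) p := by
  rw [ev_eq_sum]; rfl

/-- the constant table evaluates to `m`. [folklore] -/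
theorem ev_one (p : Equiv.Perm (Fin m) × (Fin m → Fin K)) : ev (fun _ => (1 : ℤ)) p = m := by
  rw [ev_eq_sum]; simp

/-- the tropical weight splits as `θ · slope − valuation`. [folklore] -/
theorem tropWeight_eq (θ : ℤ) (p : Equiv.Perm (Fin m) × (Fin m → Fin K)) :
    tropWeight d v θ p =
      θ * Summit.ValiantsHypothesis.ValiantsHypothesis.Theorems.LacunarySymmetroidMatrixDescartes.TropicalCensus.slope d p -
        ∑ b, v (p.1 b) b (p.2 b) := rfl

/-- **Chord slopes bracket the sampling slope.**  If `q`, `p`, `q'` are terms with `p` dominant at `θ`, `q ≠ p ≠ q'` present, and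
`slope q < slope p < slope q'`, then (cleared denominators) `V p − V q < θ·(S p − S q)` and `θ·(S q' − S p) < V q' − V p`. [folklore] -/
theorem bracket {θ : ℤ} {p q : Equiv.Perm (Fin m) × (Fin m → Fin K)} (hp : IsDominant d v ε θ p) (hq : termSign ε q ≠ 0)
    (hne : q ≠ p) :
    θ * Summit.ValiantsHypothesis.ValiantsHypothesis.Theorems.LacunarySymmetroidMatrixDescartes.TropicalCensus.slope d q -
        ∑ b, v (q.1 b) b (q.2 b) <
      θ * Summit.ValiantsHypothesis.ValiantsHypothesis.Theorems.LacunarySymmetroidMatrixDescartes.TropicalCensus.slope d p -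
        ∑ b, v (p.1 b) b (p.2 b) := by
  have h := hp.2 q hne hq
  rwa [tropWeight_eq, tropWeight_eq] at h

/-- **HINGE LAW** (chains indexed by `ℕ`).  Let `p 0, …, p n` be unique optima at integer slopes `θ 0 < ⋯ < θ n` with consecutive
terms distinct, in a design with `m ≥ 1` rows.  If integers `μ 0, …, μ n` form a linear relation among the terms as incidence vectors
(`Σ_k μ_k · ev F (p k) = 0` for every weight table `F`) and every hinge sum `Σ_{j<k≤n} μ_k (slope (p k) − slope (p j))`, `0 < j < n`, is
non-negative, then all `μ k = 0`. [folklore: Farkas dual of chain realisability; this cell] -/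
theorem hinge_law (hm : 0 < m) (n : ℕ) (θ : ℕ → ℤ) (p : ℕ → Equiv.Perm (Fin m) × (Fin m → Fin K))
    (hdom : ∀ k ≤ n, IsDominant d v ε (θ k) (p k)) (hθ : ∀ k < n, θ k < θ (k + 1)) (hne : ∀ k < n, p k ≠ p (k + 1))
    (μ : ℕ → ℤ) (hrel : ∀ F : Fin m × Fin m × Fin K → ℤ, ∑ k ∈ range (n + 1), μ k * ev F (p k) = 0)
    (hhinge : ∀ j, 0 < j → j < n → 0 ≤ ∑ k ∈ range (n + 1),
      (if j < k then μ k *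
        (Summit.ValiantsHypothesis.ValiantsHypothesis.Theorems.LacunarySymmetroidMatrixDescartes.TropicalCensus.slope d (p k) -
         Summit.ValiantsHypothesis.ValiantsHypothesis.Theorems.LacunarySymmetroidMatrixDescartes.TropicalCensus.slope d (p j))
       else 0)) :
    ∀ k ≤ n, μ k = 0 := by
  -- real (rational) data of the chain
  set S : ℕ → ℚ := fun k =>
    (Summit.ValiantsHypothesis.ValiantsHypothesis.Theorems.LacunarySymmetroidMatrixDescartes.TropicalCensus.slope d (p k) : ℚ) with hSdef
  set V : ℕ → ℚ := fun k => ((∑ b, v ((p k).1 b) b ((p k).2 b) : ℤ) : ℚ) with hVdef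
  set μ' : ℕ → ℚ := fun k => (μ k : ℚ) with hμ'
  -- slopes strictly increase along the chain
  have hSlt : ∀ k < n, S k < S (k + 1) := by
    intro k hk
    simp only [hSdef]
    exact_mod_cast Summit.ValiantsHypothesis.ValiantsHypothesis.Theorems.LacunarySymmetroidMatrixDescartes.TropicalCensus.slope_lt_of_dominant
      d v ε (hθ k hk) (hne k hk) (hdom k (by omega)) (hdom (k + 1) (by omega))
  -- gaps and chord slopes
  set s : ℕ → ℚ := fun k => S (k + 1) - S k with hsdef
  set r : ℕ → ℚ := fun k => (V (k + 1) - V k) / s k with hrdef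
  have hs : ∀ k < n, 0 < s k := fun k hk => by simp only [hsdef]; linarith [hSlt k hk]
  have hrs : ∀ k < n, r k * s k = V (k + 1) - V k := fun k hk => by
    simp only [hrdef]; rw [div_mul_cancel₀]; exact (hs k hk).ne'
  -- strict convexity: `r (j-1) < θ j < r j`
  have hr : ∀ k, k + 1 < n → r k < r (k + 1) := by
    intro k hk
    -- the middle term `p (k+1)` beats `p k` and `p (k+2)` at `θ (k+1)`
    have h1 := bracket d v ε (hdom (k + 1) (by omega)) (hdom k (by omega)).1 (hne k (by omega))
    have h2 := bracket d v ε (hdom (k + 1) (by omega)) (hdom (k + 2) (by omega)).1 (hne (k + 1) (by omega)).symm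
    have h1q := (Int.cast_lt (R := ℚ)).mpr h1
    have h2q := (Int.cast_lt (R := ℚ)).mpr h2
    push_cast at h1q h2q
    have h1' : V (k + 1) - V k < (θ (k + 1) : ℚ) * s k := by
      simp only [hVdef, hsdef, hSdef]; push_cast; linarith
    have h2' : (θ (k + 1) : ℚ) * s (k + 1) < V (k + 2) - V (k + 1) := by
      simp only [hVdef, hsdef, hSdef]; push_cast; linarith
    have hk0 := hs k (by omega)
    have hk1 := hs (k + 1) (by omega)
    have e1 : r k < (θ (k + 1) : ℚ) := by
      rw [← hrs k (by omega)] at h1'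
      exact lt_of_mul_lt_mul_right h1' hk0.le
    have e2 : (θ (k + 1) : ℚ) < r (k + 1) := by
      rw [← hrs (k + 1) (by omega)] at h2'
      exact lt_of_mul_lt_mul_right h2' hk1.le
    exact e1.trans e2
  -- the three transferred relations: constants, slopes, valuations
  have hsum : ∑ i ∈ range (n + 1), μ' i = 0 := by
    have h := hrel fun _ => 1
    simp only [ev_one] at h
    rw [← sum_mul] at h
    have h' : ∑ i ∈ range (n + 1), μ i = 0 := by
      rcases mul_eq_zero.mp h with h | h
      · exact h
      · exfalso; exact (ne_of_gt hm) (by exact_mod_cast h)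
    simp only [hμ']; exact_mod_cast h'
  have hSrel : ∑ i ∈ range (n + 1), μ' i * S i = 0 := by
    have h := hrel fun x => (d x.2.2 : ℤ)
    simp only [← slope_eq_ev] at h
    simp only [hμ', hSdef]; exact_mod_cast h
  have hVrel : ∑ i ∈ range (n + 1), μ' i * V i = 0 := by
    have h := hrel fun x => v x.1 x.2.1 x.2.2
    simp only [← val_eq_ev] at h
    simp only [hμ', hVdef]; exact_mod_cast h
  -- Abel: `Σ μ S = A_n S_n − Σ_{k<n} A_k s_k`, `Σ μ V = A_n V_n − Σ A_k (V_{k+1} − V_k)`, with `A_n = Σ μ = 0`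
  have hA_S : ∑ k ∈ range n, (∑ i ∈ range (k + 1), μ' i) * s k = 0 := by
    have h := abel μ' S n
    rw [hSrel, hsum, zero_mul, zero_sub] at h
    simp only [hsdef]
    linarith
  have hA_V : ∑ k ∈ range n, (∑ i ∈ range (k + 1), μ' i) * s k * r k = 0 := by
    have h := abel μ' V n
    rw [hVrel, hsum, zero_mul, zero_sub] at h
    have e : ∑ k ∈ range n, (∑ i ∈ range (k + 1), μ' i) * s k * r k =
        ∑ k ∈ range n, (∑ i ∈ range (k + 1), μ' i) * (V (k + 1) - V k) :=
      sum_congr rfl fun k hk => by rw [mem_range] at hk; rw [mul_assoc, mul_comm (s k), hrs k hk]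
    rw [e]; linarith
  -- hinge sums = double prefix sums
  have hB : ∀ k, k + 1 < n → 0 ≤ ∑ i ∈ range (k + 1), (∑ l ∈ range (i + 1), μ' l) * s i := by
    intro k hk
    have h := hinge_eq_double_prefix n μ' S hsum hSrel (k + 1) (by omega)
    simp only [hsdef]
    rw [← h]
    have hh := hhinge (k + 1) (by omega) hk
    have : (∑ k' ∈ range (n + 1), (if k + 1 < k' then μ' k' * (S k' - S (k + 1)) else 0)) =
        ((∑ k' ∈ range (n + 1), (if k + 1 < k' then μ k' *
          (Summit.ValiantsHypothesis.ValiantsHypothesis.Theorems.LacunarySymmetroidMatrixDescartes.TropicalCensus.slope d (p k') -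
           Summit.ValiantsHypothesis.ValiantsHypothesis.Theorems.LacunarySymmetroidMatrixDescartes.TropicalCensus.slope d (p (k + 1)))
          else 0) : ℤ) : ℚ) := by
      push_cast
      refine sum_congr rfl fun k' _ => ?_
      split_ifs <;> simp [hμ', hSdef]
    rw [this]; exact_mod_cast hh
  -- conclude
  have hcore := core n μ' s r hs hr hsum hA_S hA_V hB
  intro k hk
  have := hcore k hk
  simp only [hμ'] at this
  exact_mod_cast this

/-- **HINGE LAW, `TropRow` form** (chains indexed by `Fin (n+1)`, sign-alternating as in the hypothesis list of
`TropicalCensus.TropRootLawAt`): a linear relation `Σ_k μ_k · inc (p k) = 0` among the terms of a sign-alternating dominant chain whose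
hinge sums are all non-negative is trivial. [folklore; this cell] -/
theorem chain_hinge_law (hm : 0 < m) {n : ℕ} (θ : Fin (n + 1) → ℤ) (p : Fin (n + 1) → Equiv.Perm (Fin m) × (Fin m → Fin K))
    (hθ : StrictMono θ) (hdom : ∀ k, IsDominant d v ε (θ k) (p k))
    (halt : ∀ k : Fin n, termSign ε (p k.castSucc) * termSign ε (p k.succ) < 0)
    (μ : Fin (n + 1) → ℤ) (hrel : ∀ F : Fin m × Fin m × Fin K → ℤ, ∑ k, μ k * ev F (p k) = 0)
    (hhinge : ∀ j : Fin (n + 1), 0 < j.val → j.val < n → 0 ≤ ∑ k : Fin (n + 1),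
      (if j < k then μ k *
        (Summit.ValiantsHypothesis.ValiantsHypothesis.Theorems.LacunarySymmetroidMatrixDescartes.TropicalCensus.slope d (p k) -
         Summit.ValiantsHypothesis.ValiantsHypothesis.Theorems.LacunarySymmetroidMatrixDescartes.TropicalCensus.slope d (p j))
       else 0)) :
    μ = 0 := by
  -- extend the data to `ℕ`
  let ι : ℕ → Fin (n + 1) := fun k => ⟨min k n, by omega⟩
  have hι : ∀ k : Fin (n + 1), ι k.val = k := fun k => by ext; simp [ι]; omega
  have hιv : ∀ k ≤ n, (ι k).val = k := fun k hk => by simp [ι]; omega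
  -- consecutive terms are distinct (their signs multiply to a negative number)
  have hne' : ∀ k : Fin n, p k.castSucc ≠ p k.succ := by
    intro k h
    have := halt k
    rw [h] at this
    exact absurd this (not_lt.mpr (mul_self_nonneg _))
  have key := hinge_law d v ε hm n (fun k => θ (ι k)) (fun k => p (ι k))
    (fun k _ => hdom (ι k))
    (fun k hk => hθ (by rw [Fin.lt_def, hιv k hk.le, hιv (k + 1) hk]; omega))
    (fun k hk => by
      have h := hne' ⟨k, hk⟩
      have e1 : ι k = (⟨k, hk⟩ : Fin n).castSucc := by ext; simp [hιv k hk.le]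
      have e2 : ι (k + 1) = (⟨k, hk⟩ : Fin n).succ := by ext; simp [hιv (k + 1) hk]
      rwa [e1, e2])
    (fun k => μ (ι k))
    (fun F => by
      rw [← hrel F, ← Fin.sum_univ_eq_sum_range (fun k => μ (ι k) * ev F (p (ι k))) (n + 1)]
      exact sum_congr rfl fun k _ => by rw [hι])
    (fun j hj0 hjn => by
      have h := hhinge (ι j) (by rw [hιv j hjn.le]; exact hj0) (by rw [hιv j hjn.le]; exact hjn)
      rw [← Fin.sum_univ_eq_sum_range (fun k => if j < k then μ (ι k) *
        (Summit.ValiantsHypothesis.ValiantsHypothesis.Theorems.LacunarySymmetroidMatrixDescartes.TropicalCensus.slope d (p (ι k)) -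
         Summit.ValiantsHypothesis.ValiantsHypothesis.Theorems.LacunarySymmetroidMatrixDescartes.TropicalCensus.slope d (p (ι j)))
        else 0) (n + 1)]
      convert h using 2 with k _
      rw [hι k]
      have : (j < k.val) ↔ (ι j < k) := by rw [Fin.lt_def, hιv j hjn.le]
      simp only [this])
  funext k
  have := key k.val (by omega)
  rwa [hι] at this

end Summit.ValiantsHypothesis.ValiantsHypothesis.Theorems.KPlusLogSqLaw.HingeLaw
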